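import Summits.QuantumFields.QCD.Theses.QuarksAsStableAction
import Summits.QuantumFields.QCD.Theses.HeavyThresholdYMBridge
import Summits.QuantumFields.QCD.Theorems.QuarksAsStableActionUnquenchedChessboardBound

/-!
# Placement of the crux `QuarksAsStableAction.StableActionBridge` (stmt-QuantumFields-9737) after the re-type of
# `QCDOf` (p117723, 2026-08-16T17:37Z) — replaces the void glue p102493

Line `Sketch`, continuation lead c4, cycle 5 (helper file, `--supports stmt-QuantumFields-9737`; registered sub-goals
`thresholdQCD_of_qcd`, `stableActionBridge_of_qcd`, `chiralCompletion_of_stableActionBridge`, `stableActionBridge_iff`).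

The crux is `StableActionBridge := UnquenchedChessboardBound → WilsonQuarkStability → QCD` (A → S → QCD).  Since the
re-type, `QCDOf N_f` conjoins `reg.IsChiralAtZero` (the flavour-blind additive offset of `m_crit` is pinned to the chiral
point), so the former threshold reading `QCDOf N_f ↔ ∃ M₀ ≥ 0, …` (`GluonicCompletion.Negative.qcdOf_iff_threshold`,
behind the cycle-1 glue `qcd_of_thresholdQCD : ThresholdQCD → QCD`, p102493) is no longer available: only the direction
`QCD → ThresholdQCD` survives (`thresholdQCD_of_qcd`, offset `M₀ = 0`).  What does survive unconditionally:

* `stableActionBridge_of_qcd : QCD → StableActionBridge` — the crux is downstream of the conjunct itself;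
* `stableActionBridge_iff : StableActionBridge ↔ (WilsonQuarkStability → QCD)` — A is PROVED in the tree
  (`UnquenchedChessboardBoundLine.UnquenchedChessboardBound_of`, stmt-QuantumFields-9735), so the bridge is exactly
  "stability implies QCD";
* `chiralCompletion_of_stableActionBridge` — the crux implies the new registered stub `stub_chiralCompletion`
  (`A → S → RobustYangMillsRG → ThresholdQCD → QCD`) of the re-cut skeleton, so the re-cut loses nothing.

Pure logic over the route decls; no analysis.
-/

namespace Summit.QuantumFields.QCD.Cruxes.StableActionBridge.Sketch

open Summit.QuantumFields.QCD.Theses.QuarksAsStableAction (UnquenchedChessboardBound WilsonQuarkStability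
  StableActionBridge)
open Summit.QuantumFields.QCD.Theses.HeavyThresholdYMBridge (RobustYangMillsRG ThresholdQCD)

/-- **`QCD → ThresholdQCD`** — the surviving direction of the former threshold reading after the re-type p117723:
the re-typed conjunct `QCDOf N_f` (with `IsChiralAtZero`) gives the threshold form of route HeavyThresholdYMBridge
(item stmt-QuantumFields-8794) with offset `M₀ = 0`, for `N_f = 2, 3`. [folklore] -/
theorem thresholdQCD_of_qcd : _root_.QCD → ThresholdQCD := by
  intro h Nf hNf
  rcases hNf with rfl | rfl
  · obtain ⟨reg, hMS, -, hall⟩ := h.1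
    exact ⟨0, le_rfl, reg, hMS, hall⟩
  · obtain ⟨reg, hMS, -, hall⟩ := h.2
    exact ⟨0, le_rfl, reg, hMS, hall⟩

/-- **`QCD → StableActionBridge`**: the crux (an implication with conclusion `QCD`) is downstream of the conjunct
itself, both hypotheses unused — the only placement of the crux that survives the re-type unconditionally.
[folklore] -/
theorem stableActionBridge_of_qcd : _root_.QCD → StableActionBridge := fun h _ _ => h

/-- **The crux implies the light-quark completion stub** of the re-cut skeleton (`stub_chiralCompletion :
A → S → RobustYangMillsRG → ThresholdQCD → QCD`): given the bridge, A and S alone already give `QCD`. [folklore] -/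
theorem chiralCompletion_of_stableActionBridge :
    StableActionBridge → UnquenchedChessboardBound → WilsonQuarkStability → RobustYangMillsRG → ThresholdQCD →
      _root_.QCD :=
  fun h hA hS _ _ => h hA hS

/-- **The bridge is exactly "stability implies QCD"**: its first hypothesis A = `UnquenchedChessboardBound`
(stmt-QuantumFields-9735) is a theorem of the tree (`UnquenchedChessboardBound_of`), so
`StableActionBridge ↔ (WilsonQuarkStability → QCD)`. [folklore] -/
theorem stableActionBridge_iff : StableActionBridge ↔ (WilsonQuarkStability → _root_.QCD) :=
  ⟨fun h hS => h Summit.QuantumFields.QCD.Theorems.UnquenchedChessboardBoundLine.UnquenchedChessboardBound_of hS,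
    fun h _ hS => h hS⟩

end Summit.QuantumFields.QCD.Cruxes.StableActionBridge.Sketch
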